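import Literature.NumberTheory.GaloisRepresentations.DirichletCharacterOfGaloisCharacter
import HarnessLib

/-!
# Class X2 (odd multiplicative Eisenstein prime): the character `Γ_ℚ → 𝔽_pˣ` of a Galois module of
# prime order, and Kronecker–Weber for `𝔽_pˣ`-valued characters
# (cell `b2b-bsdres`, unit `b2b-bsdres-eisenstein-p2`, gen 21; part 1 of 3 of the UNFOLDING of the
# reading-facts A196 / p253710, see `EisensteinCongruenceOfFacts.lean`)

HONEST FRAMING (run/shared/lean/b2b/bsd-rank1-residual/, verbatim in every file): the goal of the
cell is to DELETE the COMBINATION-SHAPED residual classes of the Birch–Swinnerton-Dyer formula for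
ALL analytic-rank `≤ 1` elliptic curves over `ℚ` — "full BSD formula for every rank `≤ 1` curve in
class `C`" assembled STRICTLY from published theorems — so that the rank-`≤ 1` remainder becomes
exactly the CONSTRUCTION-SHAPED classes, which are TYPED (missing-input `Prop`s), NOT attempted.
This is not "finishing BSD". Research route; NO CLAIM BEYOND STATED CLASSES; nothing here changes a
label. Theorems only (no definition, no named fact, nothing asserted).

## What this file proves (no elliptic curve occurs)

* `exists_character_of_natCard_eq` — if a group `G` acts by additive maps on an additive group `A` of
  prime order `p`, there is a homomorphism `χ : G → 𝔽_pˣ` with `σ • x = χ(σ) • x` (GV p. 28: "`G_ℚ`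
  acts on `Φ` by a character `φ : G_ℚ → (ℤ/pℤ)ˣ`, and on `Ψ` by a character `ψ`");
  `character_eq_one_of_forall_smul_eq`, `character_eq_intCast_of_forall_smul_eq` — reading the value.
* `exists_isPrimitive_dirichletCharacter_of_isOpen_ker` — **Kronecker–Weber for an `𝔽_pˣ`-valued
  character with open kernel**: it is `σ ↦ θ(χ_N(σ))` for a PRIMITIVE Dirichlet character `θ` mod
  `N` with values in `𝔽_p` — the tree's `ℂˣ`-valued
  `exists_isPrimitive_dirichletCharacter_eq_dirichletGaloisCharacter` (over the PROVED
  `KroneckerWeber_holds`) ported verbatim to the target `𝔽_pˣ`.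
* `not_dvd_level_of_isPrimitive_of_forall_mem_inertia` — ramification read off the conductor: if
  `θ(χ_m(τ)) = 1` on the inertia group of one prime above `ℓ`, then `ℓ ∤ m` (`θ` primitive); the
  tree's `ℂ`-valued lemma of the same name, ported.

References: [Washington1997] Ch. 3 (pp. 19–21), Thm. 14.1; [NeukirchANT1999] I (10.3)–(10.4);
[GreenbergVatsal2000] §2 p. 28.
-/

set_option autoImplicit false

noncomputable section

open scoped Classical

open NumberField IsDedekindDomain Field Rat.HeightOneSpectrum
  Literature.NumberTheory.GaloisRepresentations Literature.NumberTheory.EllipticCurves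

namespace Summit.BirchSwinnertonDyer.Rank1Residual.X2.PrimeOrderCharacters

/-! ## §1. The character of a Galois module of prime order -/

section Scalar

variable {G : Type*} [Group G] {A : Type*} [AddCommGroup A] [DistribMulAction G A]
  {p : ℕ} [hp : Fact p.Prime]

omit hp in
/-- In an additive group of order `p`, an integer multiple depends only on the residue modulo `p`.
-/
theorem zsmul_eq_emod_zsmul (hA : Nat.card A = p) (a : ℤ) (x : A) :
    a • x = (a % p) • x := by
  have hpx : (p : ℤ) • x = 0 := by
    rw [natCast_zsmul, ← hA]
    exact card_nsmul_eq_zero'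
  conv_lhs => rw [← Int.emod_add_mul_ediv a p]
  rw [add_zsmul, mul_comm, mul_zsmul, hpx, zsmul_zero, add_zero]

/-- In an additive group of order `p`, `(a mod p).val • x = a • x`. -/
theorem val_intCast_smul (hA : Nat.card A = p) (a : ℤ) (x : A) :
    ((a : ZMod p).val) • x = a • x := by
  rw [← natCast_zsmul, ZMod.val_intCast, ← zsmul_eq_emod_zsmul hA]

/-- **The character of a `G`-module of prime order.** If a group `G` acts on an additive group
`A` of prime order `p` by additive maps, there is a homomorphism `χ : G → 𝔽_pˣ` with
`σ • x = χ(σ) • x` for all `σ`, `x` (the action on the cyclic group `A ≅ ℤ/p` is by scalars).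
GV p. 28: "`G_ℚ` acts on `Φ` by a character `φ : G_ℚ → (ℤ/pℤ)ˣ`, and on `Ψ` by a character
`ψ`". -/
theorem exists_character_of_natCard_eq (hA : Nat.card A = p) :
    ∃ χ : G →* (ZMod p)ˣ, ∀ (σ : G) (x : A), σ • x = ((χ σ : ZMod p).val) • x := by
  haveI : IsAddCyclic A := isAddCyclic_of_prime_card hA
  obtain ⟨g, hg⟩ := IsAddCyclic.exists_generator (α := A)
  have hord : addOrderOf g = p := by
    rw [addOrderOf_eq_card_of_forall_mem_zmultiples hg, hA]
  -- the integer scalar of `σ` on the generator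
  have hex : ∀ σ : G, ∃ n : ℤ, n • g = σ • g := fun σ ↦
    AddSubgroup.mem_zmultiples_iff.mp (hg (σ • g))
  choose n hn using hex
  -- `σ` acts as `n σ` on all of `A`
  have hact : ∀ (σ : G) (x : A), σ • x = n σ • x := by
    intro σ x
    obtain ⟨k, rfl⟩ := AddSubgroup.mem_zmultiples_iff.mp (hg x)
    rw [smul_comm σ k g, ← hn σ, ← mul_zsmul, ← mul_zsmul, mul_comm]
  -- congruences from the order of `g`
  have hcong : ∀ a b : ℤ, a • g = b • g → (a : ZMod p) = b := by
    intro a b hab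
    rw [ZMod.intCast_eq_intCast_iff_dvd_sub, ← hord, addOrderOf_dvd_iff_zsmul_eq_zero, sub_zsmul,
      hab, add_neg_cancel]
  -- the `𝔽_p`-valued hom
  let χ₀ : G →* ZMod p :=
    { toFun := fun σ ↦ (n σ : ZMod p)
      map_one' := by
        have h : n 1 • g = (1 : ℤ) • g := by rw [hn 1, one_smul, one_zsmul]
        rw [hcong _ _ h, Int.cast_one]
      map_mul' := fun σ τ ↦ by
        have h : n (σ * τ) • g = (n σ * n τ) • g := by
          rw [hn, mul_smul, hact τ g, smul_comm σ (n τ) g, hact σ g, ← mul_zsmul, mul_comm]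
        rw [hcong _ _ h, Int.cast_mul] }
  refine ⟨χ₀.toHomUnits, fun σ x ↦ ?_⟩
  rw [MonoidHom.coe_toHomUnits]
  change σ • x = ((n σ : ℤ) : ZMod p).val • x
  rw [val_intCast_smul hA, hact]

/-- The kernel of the character of §1 contains every `σ` acting trivially. -/
theorem character_eq_one_of_forall_smul_eq (hA : Nat.card A = p) {χ : G →* (ZMod p)ˣ}
    (hχ : ∀ (σ : G) (x : A), σ • x = ((χ σ : ZMod p).val) • x) {σ : G}
    (hσ : ∀ x : A, σ • x = x) : χ σ = 1 := by
  haveI : Finite A := Nat.finite_of_card_ne_zero (by rw [hA]; exact hp.out.ne_zero)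
  have h1 : 1 < Nat.card A := by rw [hA]; exact hp.out.one_lt
  obtain ⟨x, hx⟩ : ∃ x : A, x ≠ 0 := by
    by_contra h
    push Not at h
    have : Nat.card A = 1 := Nat.card_eq_one_iff_exists.mpr ⟨0, fun y ↦ h y⟩
    omega
  have hordx : addOrderOf x = p := by
    have hdvd : addOrderOf x ∣ p := hA ▸ addOrderOf_dvd_natCard x
    rcases (Nat.dvd_prime hp.out).mp hdvd with h | h
    · exact absurd (AddMonoid.addOrderOf_eq_one_iff.mp h) hx
    · exact h
  -- `χ σ • x = x = 1 • x`, so `χ σ = 1` in `𝔽_p`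
  have hval : ((χ σ : ZMod p).val : ℤ) • x = (1 : ℤ) • x := by
    rw [natCast_zsmul, ← hχ σ x, hσ x, one_zsmul]
  have hdvd : (addOrderOf x : ℤ) ∣ 1 - ((χ σ : ZMod p).val : ℤ) := by
    rw [addOrderOf_dvd_iff_zsmul_eq_zero, sub_zsmul, hval, add_neg_cancel]
  rw [hordx] at hdvd
  have hcong : (((χ σ : ZMod p).val : ℤ) : ZMod p) = ((1 : ℤ) : ZMod p) :=
    (ZMod.intCast_eq_intCast_iff_dvd_sub _ _ p).mpr hdvd
  rw [Int.cast_natCast, ZMod.natCast_zmod_val, Int.cast_one] at hcong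
  exact Units.ext hcong

end Scalar

/-! ## §2. Kronecker–Weber: characters `Γ_ℚ → 𝔽_pˣ` with open kernel are Dirichlet characters -/

section KroneckerWeber

variable {p : ℕ} [hp : Fact p.Prime]

/-- **Kronecker–Weber for an `𝔽_pˣ`-valued character**: a homomorphism `χ : Γ_ℚ → 𝔽_pˣ` with open
kernel is `σ ↦ θ(χ_N(σ))` for a PRIMITIVE Dirichlet character `θ` modulo some `N ≥ 1` with values
in `𝔽_p` (`χ_N` the mod-`N` cyclotomic character). The tree's
`exists_isPrimitive_dirichletCharacter_eq_dirichletGaloisCharacter` (for `ℂˣ`-valued characters),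
verbatim with `𝔽_p` in place of `ℂ` (`exists_forall_smul_eq_self_imp_eq_one_of_isKroneckerWeber`
with `KroneckerWeber_holds`, surjectivity of `χ_m`, then the primitive character). -/
theorem exists_isPrimitive_dirichletCharacter_of_isOpen_ker (χ : absoluteGaloisGroup ℚ →* (ZMod p)ˣ)
    (hker : IsOpen ((χ.ker : Subgroup (absoluteGaloisGroup ℚ)) : Set (absoluteGaloisGroup ℚ))) :
    ∃ (N : ℕ) (_ : NeZero N) (θ : DirichletCharacter (ZMod p) N), θ.IsPrimitive ∧
      ∀ σ : absoluteGaloisGroup ℚ,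
        (χ σ : ZMod p) = θ ((modNCyclotomicCharacter ℚ N σ : (ZMod N)ˣ) : ZMod N) := by
  obtain ⟨m, hm, hfixm⟩ :=
    exists_forall_smul_eq_self_imp_eq_one_of_isKroneckerWeber KroneckerWeber_holds χ hker
  haveI : NeZero m := ⟨hm.ne'⟩
  set c : absoluteGaloisGroup ℚ →* (ZMod m)ˣ := modNCyclotomicCharacter ℚ m with hcdef
  have hle : c.ker ≤ χ.ker := by
    intro σ hσ
    rw [MonoidHom.mem_ker] at hσ ⊢
    refine hfixm σ fun ζ hζ => ?_
    rw [modNCyclotomicCharacter_spec ℚ m σ ζ hζ, ← hcdef, hσ, Units.val_one]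
    rcases Nat.lt_or_ge 1 m with h1 | h1
    · rw [ZMod.val_one'' h1.ne', pow_one]
    · have hm1 : m = 1 := le_antisymm h1 hm
      subst hm1
      rw [pow_one] at hζ
      rw [hζ, one_pow]
  have hsurj : Function.Surjective c := modNCyclotomicCharacter_rat_surjective m
  have hs : Function.RightInverse (Function.surjInv hsurj) c := Function.rightInverse_surjInv hsurj
  set θ₀ : (ZMod m)ˣ →* (ZMod p)ˣ :=
    MonoidHom.liftOfRightInverse c (Function.surjInv hsurj) hs ⟨χ, hle⟩ with hθ₀
  have hθ₀c : ∀ σ, θ₀ (c σ) = χ σ := fun σ =>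
    MonoidHom.liftOfRightInverse_comp_apply c (Function.surjInv hsurj) hs ⟨χ, hle⟩ σ
  -- the (possibly imprimitive) Dirichlet character modulo `m`
  set θ : DirichletCharacter (ZMod p) m := MulChar.ofUnitHom θ₀ with hθ
  have hθσ : ∀ σ, (χ σ : ZMod p) = θ ((c σ : (ZMod m)ˣ) : ZMod m) := fun σ ↦ by
    rw [hθ, MulChar.ofUnitHom_coe, hθ₀c]
  -- pass to the primitive character
  haveI : NeZero θ.conductor := ⟨θ.conductor_ne_zero⟩
  refine ⟨θ.conductor, inferInstance, θ.primitiveCharacter, θ.primitiveCharacter_isPrimitive,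
    fun σ => ?_⟩
  rw [hθσ σ, ← cast_modNCyclotomicCharacter ℚ θ.conductor_dvd_level σ,
    ← DirichletCharacter.changeLevel_eq_cast_of_dvd _ θ.conductor_dvd_level,
    DirichletCharacter.changeLevel_primitiveCharacter]

/-- **Ramification is read off the conductor** (`𝔽_p`-valued version of the tree's
`not_dvd_level_of_isPrimitive_of_forall_mem_inertia`): if `θ` is a primitive Dirichlet character
modulo `m` with values in `𝔽_p` and `θ(χ_m(τ)) = 1` for every `τ` in the inertia group of one prime
`𝔓` of `ℤ̄` above the rational prime `ℓ`, then `ℓ ∤ m` (Washington Ch. 3; Neukirch I (10.3)–(10.4)).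
-/
theorem not_dvd_level_of_isPrimitive_of_forall_mem_inertia {m : ℕ} [NeZero m]
    {θ : DirichletCharacter (ZMod p) m} (hθ : θ.IsPrimitive) {ℓ : ℕ} (hℓ : ℓ.Prime)
    {v : HeightOneSpectrum (𝓞 ℚ)} (hv : (ℓ : 𝓞 ℚ) ∈ v.asIdeal)
    {𝔓 : Ideal (absIntegers (𝓞 ℚ) ℚ)} (h𝔓 : 𝔓 ∈ v.primesAbove)
    (h1 : ∀ τ ∈ 𝔓.inertia (absoluteGaloisGroup ℚ),
      θ ((modNCyclotomicCharacter ℚ m τ : (ZMod m)ˣ) : ZMod m) = 1) :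
    ¬ ℓ ∣ m := by
  haveI : Fact ℓ.Prime := ⟨hℓ⟩
  intro hℓm
  -- `m = ℓ^{k+1} d`, `ℓ ∤ d`
  obtain ⟨e, d, hd, hmd⟩ := Nat.exists_eq_pow_mul_and_not_dvd (NeZero.ne m) ℓ hℓ.ne_one
  have he : e ≠ 0 := by
    rintro rfl
    rw [pow_zero, one_mul] at hmd
    exact hd (hmd ▸ hℓm)
  obtain ⟨k, rfl⟩ := Nat.exists_eq_succ_of_ne_zero he
  -- `θ` factors through `d`
  have hfac : θ.FactorsThrough d := by
    rw [DirichletCharacter.factorsThrough_iff_ker_unitsMap (Dvd.intro_left _ hmd.symm)]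
    intro a ha
    rw [MonoidHom.mem_ker] at ha ⊢
    obtain ⟨τ, hτ, hτa⟩ := exists_mem_inertia_modNCyclotomicCharacter_eq hmd hd
      (natGenerator_eq_of_natCast_mem_asIdeal hℓ hv) h𝔓 ha
    have h := h1 τ hτ
    rw [hτa] at h
    ext
    rw [MulChar.coe_toUnitHom, h, Units.val_one]
  have hcond : θ.conductor ∣ d := DirichletCharacter.conductor_dvd_of_mem_conductorSet θ hfac
  rw [hθ] at hcond
  exact hd ((dvd_pow_self ℓ (Nat.succ_ne_zero k)).trans ((Dvd.intro d hmd.symm).trans hcond))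

/-- A Dirichlet character composed with the cyclotomic character, as a hom `Γ_ℚ → 𝔽_pˣ`. -/
theorem coe_toUnitHom_comp {m : ℕ} [NeZero m] (φ : DirichletCharacter (ZMod p) m)
    (σ : absoluteGaloisGroup ℚ) :
    ((φ.toUnitHom.comp (modNCyclotomicCharacter ℚ m) σ : (ZMod p)ˣ) : ZMod p) =
      φ ((modNCyclotomicCharacter ℚ m σ : (ZMod m)ˣ) : ZMod m) := by
  rw [MonoidHom.comp_apply, MulChar.coe_toUnitHom]

end KroneckerWeber

/-- In a `G`-module of prime order `p` with character `χ`: if `σ` acts as the integer `a`, then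
`χ(σ) = a` in `𝔽_p`. -/
theorem character_eq_intCast_of_forall_smul_eq {G : Type*} [Group G] {A : Type*} [AddCommGroup A]
    [DistribMulAction G A] {p : ℕ} [hp : Fact p.Prime] (hA : Nat.card A = p)
    {χ : G →* (ZMod p)ˣ} (hχ : ∀ (σ : G) (x : A), σ • x = ((χ σ : ZMod p).val) • x) {σ : G}
    {a : ℤ} (hσ : ∀ x : A, σ • x = a • x) : (χ σ : ZMod p) = a := by
  haveI : Finite A := Nat.finite_of_card_ne_zero (by rw [hA]; exact hp.out.ne_zero)
  have h1 : 1 < Nat.card A := by rw [hA]; exact hp.out.one_lt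
  obtain ⟨x, hx⟩ : ∃ x : A, x ≠ 0 := by
    by_contra h
    push Not at h
    have : Nat.card A = 1 := Nat.card_eq_one_iff_exists.mpr ⟨0, fun y ↦ h y⟩
    omega
  have hordx : addOrderOf x = p := by
    have hdvd : addOrderOf x ∣ p := hA ▸ addOrderOf_dvd_natCard x
    rcases (Nat.dvd_prime hp.out).mp hdvd with h | h
    · exact absurd (AddMonoid.addOrderOf_eq_one_iff.mp h) hx
    · exact h
  have hval : ((χ σ : ZMod p).val : ℤ) • x = a • x := by
    rw [natCast_zsmul, ← hχ σ x, hσ x]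
  have hdvd : (addOrderOf x : ℤ) ∣ a - ((χ σ : ZMod p).val : ℤ) := by
    rw [addOrderOf_dvd_iff_zsmul_eq_zero, sub_zsmul, hval, add_neg_cancel]
  rw [hordx] at hdvd
  have hcong : (((χ σ : ZMod p).val : ℤ) : ZMod p) = ((a : ℤ) : ZMod p) :=
    (ZMod.intCast_eq_intCast_iff_dvd_sub _ _ p).mpr hdvd
  rwa [Int.cast_natCast, ZMod.natCast_zmod_val] at hcong

end Summit.BirchSwinnertonDyer.Rank1Residual.X2.PrimeOrderCharacters

end
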